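import Summits.ResolutionOfSingularities.ResolutionOfSingularities.Theses.FrobeniusClosing
import Summits.ResolutionOfSingularities.ResolutionOfSingularities.Theorems.FrobeniusClosingDefs
import Summits.ResolutionOfSingularities.ResolutionOfSingularities.Theorems.JacobianBudgetDefs
import HarnessLib

/-!
# Crux `BoundedMilnor` (stmt-ResolutionOfSingularities-16346) — line `jacobian-budget`, lead's skeleton v2
# (shared engines with the sibling crux stmt-18946 + the lead's kits for the budget argument)

Route `ResolutionOfSingularities/FrobeniusClosing`; the crux BY NAME is
`FrobeniusClosing.BoundedMilnor` ("NO PUMPING"): along an infinite chain of isolated multiplicity-`p`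
states `a_m = run c₀ i t m` of the point-blow-up dynamics of `zᵖ = a(u₁,…,uₙ)` over a perfect field
of characteristic `p`, `μ(a_m) = dim κ⟦u⟧ ⧸ (∂a_m)` is bounded.

## Vocabulary

The crux's thirteen `let`s are VERBATIM the Theorems-side calculus
`Theorems/WildConesClassicalRegimesDefs.lean` (`clean bl ord dv tr step run ser pd jac Isol MultP mu`,
explicit arguments `p n κ`; definitionally equal, body by body, to `Theorems/FrobeniusClosingDefs.lean`,
from which only `chartMap` is used here), and the sibling crux `JacobianBudget.IsolatedJacobianDrop`
(stmt-18946, line `euler-noether`, live) has landed `Theorems/JacobianBudgetDefs.lean` with the shared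
engine statements `BaseChange`, `NoExcess`, `PolarAdditivity`, `MixedNoether` and the vocabulary `form`,
`ExcFinite`, `pt`, `NF`, `locT`, `Δ`. This skeleton CONSUMES those (one proof serves both cruxes) and adds
the lead's kits for the one piece the sibling line leaves monolithic (its `stub_budgetOfEngines`): the
budget ARGUMENT, with the genericity of the auxiliary hyperplane replaced by algebra.

## The line

`BoundedMilnor ⇐ (a step never raises μ) ⇐ BaseChange + NoExcess + OnePointBudget`, and
`OnePointBudget ⇐ TransformKit + PolarAdditivity + MixedNoether + GaussAvoidance + AutKit + SectionKit`
(stub `stub_exceptionalBudget`, held by the lead). We need only the Δ-free one-point inequality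
`mu (step i τ c) ≤ mu c`; the sharp law `Σ_Q mu_Q + Δ_n(p) = mu` is proved on the way (induction).

* `TransformKit` (S3): `d(u_iᵖ a') = u_iᵖ da'` in characteristic `p`, so `σ = chartMap i τ` carries
  `∂_j a ↦ u_i^{p-1} ∂_j a'` (`j ≠ i`), `∂_i a ↦ u_i^{p-1}(u_i ∂_i a' − Σ_{j≠i}(u_j+τ_j) ∂_j a')`,
  `θa = Σ u_j ∂_j a ↦ u_i^{p+1} ∂_i a'`; on `E = {u_i = 0}`: `∂_j a' ≡ ∂_jF(ṽ)`, `∂_i a' ≡ G(ṽ)`.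
* `AutKit` (S4): covariance of `mu`, `Isol`, `MultP`, of the successor `mu`'s (explicit action of the
  linear part on exceptional points) and of the two lowest forms under a formal automorphism.
* `GaussAvoidance` (S5): forms `Φ` (degree `p = char`), `Ψ ≠ 0` with `V(∂Φ, Ψ)` finite ⇒ after a linear
  change the restrictions to `X_last = 0` keep `Ψ| ≠ 0` and `V(∂(Φ|), Ψ|)` finite (the Gauss image of
  the hypersurface `V(Ψ)` misses a covector: `m+1` functions on an `m`-dimensional variety are dependent).
* `SectionKit` (S6): graph elimination `L⟦u', u_N⟧/(I, u_N − η(u')) ≅ L⟦u'⟧/I(u', η)`; the formal implicit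
  function `η = h(u', η)`; tangential derivatives commute with restriction when `dη = 0`; and FINITE PRIME
  AVOIDANCE: for isolated `a`, `(∂_{j<N} a, u_N + λ (∂_N a)^{2p})` has finite colength for all but finitely
  many `λ` (a minimal prime of `(∂_{j<N} a)` contains at most one such element).

PLAN for `stub_exceptionalBudget` (lead): induction on `n` for the EQUALITY
`Σ_{all exceptional Q (normal form)} mu(step Q c) + Δ_n(p) = mu c` over `L = L̄` for isolated
multiplicity-`p` `c` with `ExcFinite c` and `G ≠ 0` (WLOG: `NoExcess`/`ExcFinite` forces `F ≠ 0 ∨ G ≠ 0`,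
and a shear `u_j ↦ u_j + q` (AutKit) replaces `G` by `G + ∂_jF·q` keeping `F`, `mu`, all `mu_Q`).
Step: permute the chart of interest to `N = last` (AutKit); EULER-TYPE SYSTEM
`f = (∂_j a (j < N), θa + λ (∂_N a)^{2p+1})`, weights `(p-1,…,p-1,p+1)`;
`dim R⧸(f) = mu a + dim R/(∂_{j<N} a, x_λ)`, `x_λ = u_N + λ(∂_N a)^{2p}` (PolarAdditivity:
`θa ≡ u_N ∂_N a`), `= mu a + mu b` with `b = a|_{x_λ = 0}` an `n-1`-variable state (SectionKit: the
graph `u_N = η` has `dη = 0`, so `∂_j b = (∂_j a)|`; good `λ` exists since `L` is infinite); by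
TransformKit the transforms of `f` generate `J(a')` off the strict transform `S̃` of `{x_λ = 0}` and,
at `x ∈ S̃ ∩ E = ℙ(u_N = 0)`, the ideal `(∂'_{j∉{l,N}} a', ∂'_l a' + λ u_l^c (∂'_N a')^{2p+1}, ∂'_N a' · w̃)`
(`c = 2p²-2p-2`, `w̃ = w + λ u_l^{c+1}(∂'_N a')^{2p}` the strict transform of `x_λ`, and
`−(c+1) ≡ 1 (mod p)` makes the middle generator `∂_l(a'|_{S̃})`), of local length `mu_x(a') + mu_x̄(b')`
(PolarAdditivity + SectionKit again); GaussAvoidance (on `(F|, G|)`, after AutKit) makes `b` of the same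
kind; MixedNoether: `Σ_Q mu_Q(a') + Σ_x̄ mu_x̄(b') = mu a + mu b − (p-1)^{n-1}(p+1)`; induction:
`Σ_x̄ mu_x̄(b') = mu b − Δ_{n-1}(p)`; `(p-1)^{n-1}(p+1) − Δ_{n-1}(p) = Δ_n(p)`; `n = 1`:
`JacobianBudget.stub_singleStepN1` (landed).

Composition here (sorry-free): `singleStep_of`, `BoundedMilnor_of` (a step never raises `mu`, so
`β := mu (run 0)`), `BoundedMilnor_proof`.

Disproof / evidence used: no `Disproof.lean` for this crux; sibling Disproof v2 (stmt-18946): `MultP`,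
`Isol` at `m` load-bearing, `PerfectField` unused by the law — consistent; refuter ARENA-SHARPENING
(`n ≥ 3 ⇒ ord = p`, `n = 2 ⇒ ord ≥ p+1`) is the source of "`F ≠ 0 ∨ G ≠ 0`"; censuses: 0 rises in > 6 000
certified transitions. v1 of this skeleton (sha 73a14ab1…) stated the shared engines over
`FrobeniusClosing.*` names; v2 switches to the sibling's landed statements.
-/

-- single-problem summit: the doubled namespace component `ResolutionOfSingularities` is forced
set_option linter.dupNamespace false

noncomputable section

open scoped BigOperators Classical

open Summit.ResolutionOfSingularities.ResolutionOfSingularities.Theses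
open Summit.ResolutionOfSingularities.ResolutionOfSingularities.Theorems.WildCones
  (clean bl ord dv tr step run ser pd jac Isol MultP mu)
open Summit.ResolutionOfSingularities.ResolutionOfSingularities.Theorems.JacobianBudget
  (form ExcFinite pt NF locT BaseChange NoExcess PolarAdditivity MixedNoether)
open Summit.ResolutionOfSingularities.ResolutionOfSingularities.Theorems.FrobeniusClosing (chartMap)

namespace Summit.ResolutionOfSingularities.ResolutionOfSingularities.Theorems.BoundedMilnorBudget

/-! ## The lead's kit STATEMENTS (bodies over tree-resident names only; local copies, to become
`Theorems/FrobeniusClosingBoundedMilnorDefs.lean`, same namespace `…Theorems.BoundedMilnorBudget`, after which this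
file imports it and drops the copies) -/

/-- **S3 · transform kit (the Euler transform identities for a general exceptional point, and the
exceptional restriction).** For a multiplicity-`p` state over a perfect field of characteristic `p`, with
`a = ser c`, `a' = ser (step i τ c)`, `σ = chartMap i τ`: `σ(∂_j a) = u_i^{p-1} ∂_j a'` (`j ≠ i`),
`σ(∂_i a) = u_i^{p-1}(u_i ∂_i a' − Σ_{j≠i}(u_j+τ_j)∂_j a')`, `σ(θa) = u_i^{p+1} ∂_i a'`; and modulo `u_i`,
`∂_j a' ≡ (∂_jF)(ṽ)` (`j ≠ i`), `∂_i a' ≡ G(ṽ)`, where `F = form p p c`, `G = form p (p+1) c` and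
`ṽ_l = u_l + τ_l` (`l ≠ i`), `ṽ_i = 1` (`σ(a) = u_iᵖ(a' + hᵖ)` — tree `exists_chartMap_ser_eq` —, `d` kills
`p`-th powers, chain rule `pd_subst`). [folklore] -/
def TransformKit : Prop :=
  ∀ p : ℕ, p.Prime → ∀ (n : ℕ) (L : Type) [Field L] [CharP L p] [PerfectField L]
    (c : (Fin n → ℕ) → L) (i : Fin n) (τ : Fin n → L), MultP p n L c →
    let a := ser p n L c
    let a' := ser p n L (step p n L i τ c)
    let σ := chartMap n L i τ
    let ev : MvPolynomial (Fin n) L → MvPowerSeries (Fin n) L := fun P =>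
      ((MvPolynomial.aeval (fun l => if l = i then (1 : MvPolynomial (Fin n) L)
        else MvPolynomial.X l + MvPolynomial.C (τ l)) P : MvPolynomial (Fin n) L) :
          MvPowerSeries (Fin n) L)
    (∀ j, j ≠ i → σ (pd n L j a) = MvPowerSeries.X i ^ (p - 1) * pd n L j a') ∧
    σ (pd n L i a) = MvPowerSeries.X i ^ (p - 1) *
      (MvPowerSeries.X i * pd n L i a' -
        ∑ j ∈ Finset.univ.erase i, (MvPowerSeries.X j + MvPowerSeries.C (τ j) : MvPowerSeries (Fin n) L) * pd n L j a') ∧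
    σ (∑ j, MvPowerSeries.X j * pd n L j a) = MvPowerSeries.X i ^ (p + 1) * pd n L i a' ∧
    (∀ j, j ≠ i → MvPowerSeries.X i ∣ (pd n L j a' - ev (MvPolynomial.pderiv j (form p p c)))) ∧
    MvPowerSeries.X i ∣ (pd n L i a' - ev (form p (p + 1) c))

/-- **S4 · automorphism kit.** For a substitution `Φ` of `L⟦u⟧` with zero constant terms and invertible
linear part `A` (`A j l = ` coefficient of `u_l` in `Φ j`, so `Φ(u) = A u + O(u²)`), the state `c ∘ Φ`
(coefficients of `(ser c)(Φ)`, i.e. of `a(Φ(u))`) has the same `Isol`, `MultP`, `mu`; its successor at an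
exceptional point `q'` has the same `Isol`/`mu` as the successor of `c` at `q` whenever `A · pt q' ∥ pt q`;
its tangent form is `F ∘ A` up to `p`-th-power monomials (so the partial derivatives agree) and its next
form is `G ∘ A + Σ_j (∂_j F ∘ A) · Φ_j⁽²⁾` (`Φ_j⁽²⁾` the quadratic part; degree `p+1` holds no `p`-th power)
(chain rule; the point blow-up is functorial: tree `stub_factorization`, `exists_chartPoint`). [folklore] -/
def AutKit : Prop :=
  ∀ p : ℕ, p.Prime → ∀ (n : ℕ) (L : Type) [Field L] [CharP L p]
    (c : (Fin n → ℕ) → L) (Φ : Fin n → MvPowerSeries (Fin n) L),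
    (∀ j, MvPowerSeries.constantCoeff (Φ j) = 0) →
    IsUnit (Matrix.of fun j l => MvPowerSeries.coeff (Finsupp.single l 1) (Φ j)).det →
    let A : Matrix (Fin n) (Fin n) L := Matrix.of fun j l => MvPowerSeries.coeff (Finsupp.single l 1) (Φ j)
    let cΦ : (Fin n → ℕ) → L := fun B =>
      MvPowerSeries.coeff (Finsupp.equivFunOnFinite.symm B) (MvPowerSeries.subst Φ (ser p n L c))
    let lin : MvPolynomial (Fin n) L → MvPolynomial (Fin n) L :=
      fun P => MvPolynomial.aeval (fun j => ∑ l, MvPolynomial.C (A j l) * MvPolynomial.X l) P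
    let quad : Fin n → MvPolynomial (Fin n) L := fun j =>
      ∑ B ∈ Finset.Nat.antidiagonalTuple n 2,
        MvPolynomial.monomial (Finsupp.equivFunOnFinite.symm B)
          (MvPowerSeries.coeff (Finsupp.equivFunOnFinite.symm B) (Φ j))
    (Isol p n L cΦ ↔ Isol p n L c) ∧ (MultP p n L cΦ ↔ MultP p n L c) ∧ mu p n L cΦ = mu p n L c ∧
    (∀ (q q' : Fin n × (Fin n → L)), (∃ s : L, s ≠ 0 ∧ A.mulVec (pt q') = s • pt q) →
        (Isol p n L (step p n L q'.1 q'.2 cΦ) ↔ Isol p n L (step p n L q.1 q.2 c)) ∧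
        mu p n L (step p n L q'.1 q'.2 cΦ) = mu p n L (step p n L q.1 q.2 c)) ∧
    (∀ j, MvPolynomial.pderiv j (form p p cΦ) = MvPolynomial.pderiv j (lin (form p p c))) ∧
    form p (p + 1) cΦ = lin (form p (p + 1) c) + ∑ j, lin (MvPolynomial.pderiv j (form p p c)) * quad j

/-- **S5 · Gauss avoidance (projective geometry of two forms).** Over an algebraically closed field of
characteristic `p`, in `m + 1 ≥ 2` variables (`0 < m`): if `Φ` is a form of degree `p`, `Ψ ≠ 0` a form, and the
projective scheme `V(∂₀Φ,…,∂ₘΦ, Ψ)` is finite (every dehomogenisation is finite-dimensional), then after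
an invertible linear change of coordinates the restrictions `Φ|, Ψ|` to the hyperplane `X_last = 0`
satisfy `Ψ| ≠ 0` and `V(∂(Φ|), Ψ|)` finite. (Points of the latter are the points `y ∈ V(Ψ) ∩ H` with
`dΦ_y ∥ λ_H` — `λ_H(y) = p·Φ(y)/c = 0` by Euler —; the `m+1` partials are algebraically dependent on each
component of the hypersurface `V(Ψ)`, so a homogeneous `R ≠ 0` vanishes on the Gauss image, and any `λ`
with `R(λ)·Ψ(λ(v)u − λ(u)v) ≠ 0` works.) [folklore] -/
def GaussAvoidance : Prop :=
  ∀ p : ℕ, p.Prime → ∀ m : ℕ, 0 < m → ∀ (L : Type) [Field L] [CharP L p] [IsAlgClosed L]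
    (Φ Ψ : MvPolynomial (Fin (m + 1)) L) (d : ℕ),
    Φ.IsHomogeneous p → Ψ.IsHomogeneous d → Ψ ≠ 0 →
    (∀ j, Module.Finite L (MvPolynomial (Fin (m + 1)) L ⧸
      (Ideal.span (insert Ψ (Set.range fun l => MvPolynomial.pderiv l Φ)) ⊔
        Ideal.span {MvPolynomial.X j - 1}))) →
    ∃ g : Matrix (Fin (m + 1)) (Fin (m + 1)) L, IsUnit g.det ∧
      let lin : MvPolynomial (Fin (m + 1)) L → MvPolynomial (Fin (m + 1)) L :=
        fun P => MvPolynomial.aeval (fun j => ∑ l, MvPolynomial.C (g l j) * MvPolynomial.X l) P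
      let res : MvPolynomial (Fin (m + 1)) L → MvPolynomial (Fin m) L :=
        fun P => MvPolynomial.aeval (fun l : Fin (m + 1) =>
          Fin.lastCases (0 : MvPolynomial (Fin m) L) (fun l' => MvPolynomial.X l') l) P
      res (lin Ψ) ≠ 0 ∧
      ∀ j, Module.Finite L (MvPolynomial (Fin m) L ⧸
        (Ideal.span (insert (res (lin Ψ)) (Set.range fun l => MvPolynomial.pderiv l (res (lin Φ)))) ⊔
          Ideal.span {MvPolynomial.X j - 1}))


/-- **S6 · section kit (graph elimination, formal implicit function, finite prime avoidance).** Over a field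
of characteristic `p`, in `R = L⟦u₀,…,u_N⟧` (`N = n`, `u' = (u₀,…,u_{n-1})`, `R' = L⟦u'⟧`):
(i) for `η ∈ 𝔪'` the substitution `ρ_η : u_j ↦ u_j (j < N), u_N ↦ η` is onto `R'`, its kernel is
`(u_N − η)`, colengths of `I + (u_N − η)` and of `ρ_η(I)` agree, and `∂_j ∘ ρ_η = ρ_η ∘ ∂_j` (`j < N`) when
`dη = 0`; (ii) for `h ∈ R` with no constant and no `u_N`-linear term there is `η ∈ 𝔪'` with
`η = ρ_η(h)`, and then `(u_N − h) = (u_N − η)` as ideals; (iii) for `a` with `R/(∂a)` finite, the set of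
`λ` for which `R/(∂_{j<N} a, u_N + λ(∂_N a)^{2p})` is NOT finite over `L` is finite (a minimal prime of
`(∂_{j<N} a)` containing two such elements would contain `∂_N a`, hence all of `(∂a)`). [folklore] -/
def SectionKit : Prop :=
  ∀ p : ℕ, p.Prime → ∀ (n : ℕ) (L : Type) [Field L] [CharP L p],
    let R := MvPowerSeries (Fin (n + 1)) L
    let R' := MvPowerSeries (Fin n) L
    let ι : R' → R := fun g => MvPowerSeries.subst (fun j : Fin n => (MvPowerSeries.X (Fin.castSucc j) : R)) g
    let ρ : R' → R → R' := fun η f =>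
      MvPowerSeries.subst (Fin.lastCases (motive := fun _ => R') η (fun j : Fin n => (MvPowerSeries.X j : R'))) f
    (∀ η : R', MvPowerSeries.constantCoeff η = 0 →
      Function.Surjective (ρ η) ∧
      (∀ f : R, ρ η f = 0 ↔ ((MvPowerSeries.X (Fin.last n) : R) - ι η) ∣ f) ∧
      (∀ I : Ideal R,
        (Module.Finite L (R ⧸ (I ⊔ Ideal.span {(MvPowerSeries.X (Fin.last n) : R) - ι η})) ↔
          Module.Finite L (R' ⧸ Ideal.span (ρ η '' (I : Set R)))) ∧
        Module.finrank L (R ⧸ (I ⊔ Ideal.span {(MvPowerSeries.X (Fin.last n) : R) - ι η})) =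
          Module.finrank L (R' ⧸ Ideal.span (ρ η '' (I : Set R)))) ∧
      ((∀ j, pd n L j η = 0) → ∀ (f : R) (j : Fin n),
        pd n L j (ρ η f) = ρ η (pd (n + 1) L (Fin.castSucc j) f))) ∧
    (∀ h : R, MvPowerSeries.constantCoeff h = 0 →
      MvPowerSeries.coeff (Finsupp.single (Fin.last n) 1) h = 0 →
      ∃ η : R', MvPowerSeries.constantCoeff η = 0 ∧ η = ρ η h ∧
        Ideal.span {(MvPowerSeries.X (Fin.last n) : R) - h} = Ideal.span {(MvPowerSeries.X (Fin.last n) : R) - ι η}) ∧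
    (∀ a : R, Module.Finite L (R ⧸ Ideal.span (Set.range fun j => pd (n + 1) L j a)) →
      Set.Finite {lam : L | ¬ Module.Finite L (R ⧸
        (Ideal.span (Set.range fun j : Fin n => pd (n + 1) L (Fin.castSucc j) a) ⊔
          Ideal.span {(MvPowerSeries.X (Fin.last n) : R) +
            (MvPowerSeries.C lam : R) * pd (n + 1) L (Fin.last n) a ^ (2 * p)}))})

/-- **The ONE-POINT BUDGET (what the crux needs).** Over an algebraically closed field of characteristic
`p`: if `c` is isolated of multiplicity `p` with finite exceptional critical scheme (`ExcFinite`), then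
`mu (step i τ c) ≤ mu c` at every exceptional point whose successor is isolated of multiplicity `p`. The
expected truth is the EQUALITY `Σ_{all Q ∈ E} mu_Q + Δ_n(p) = mu c` (censuses: slack `0` attained);
target of `stub_exceptionalBudget`. [folklore] -/
def OnePointBudget : Prop :=
  ∀ p : ℕ, p.Prime → ∀ n : ℕ, 0 < n → ∀ (L : Type) [Field L] [CharP L p] [IsAlgClosed L]
    (c : (Fin n → ℕ) → L) (i : Fin n) (τ : Fin n → L),
    Isol p n L c → MultP p n L c → ExcFinite p c →
    Isol p n L (step p n L i τ c) → MultP p n L (step p n L i τ c) →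
    mu p n L (step p n L i τ c) ≤ mu p n L c

/-! ## The stub statements BY STUB NAME (`Sig.stub_<name>`: the skeleton audit admits a hypothesis of the
composition only when its head constant carries the stub's name) -/

/-- statement of `stub_sharedKits`. [folklore] -/
abbrev Sig.stub_sharedKits : Prop := BaseChange ∧ NoExcess ∧ PolarAdditivity
/-- statement of `stub_mixedNoether`. [folklore] -/
abbrev Sig.stub_mixedNoether : Prop := MixedNoether
/-- statement of `stub_transformKit`. [folklore] -/
abbrev Sig.stub_transformKit : Prop := TransformKit
/-- statement of `stub_autKit`. [folklore] -/
abbrev Sig.stub_autKit : Prop := AutKit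
/-- statement of `stub_gaussAvoidance`. [folklore] -/
abbrev Sig.stub_gaussAvoidance : Prop := GaussAvoidance
/-- statement of `stub_sectionKit`. [folklore] -/
abbrev Sig.stub_sectionKit : Prop := SectionKit
/-- statement of `stub_exceptionalBudget`: the one-point budget from the engines. [folklore] -/
abbrev Sig.stub_exceptionalBudget : Prop :=
  TransformKit → PolarAdditivity → MixedNoether → GaussAvoidance → AutKit → SectionKit → OnePointBudget

/-! ## The stubs -/

/-- **Stub S1 (shared with crux stmt-18946, whose line `euler-noether` files them one by one): base change,
no excess, polar additivity.** See `Theorems/JacobianBudgetDefs.lean`. [folklore] -/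
theorem stub_sharedKits : BaseChange ∧ NoExcess ∧ PolarAdditivity := by
  sorry

/-- **Stub S2 (shared, XL): Max Noether for mixed transforms.** See `JacobianBudget.MixedNoether`.
[cite: Fulton, Intersection Theory (1998), Example 12.4.8] -/
theorem stub_mixedNoether : MixedNoether := by
  sorry

/-- **Stub S3 (M): transform kit.** See `TransformKit`. [folklore] -/
theorem stub_transformKit : TransformKit := by
  sorry

/-- **Stub S4 (L): automorphism kit.** See `AutKit`. [folklore] -/
theorem stub_autKit : AutKit := by
  sorry

/-- **Stub S5 (L): Gauss avoidance.** See `GaussAvoidance`. [folklore] -/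
theorem stub_gaussAvoidance : GaussAvoidance := by
  sorry

/-- **Stub S6 (M/L): section kit.** See `SectionKit` (tree: `Literature/RingTheory/MvPowerSeries/
WeierstrassDivision`, `CoordinateDivision`; Mathlib minimal primes, Krull height). [folklore] -/
theorem stub_sectionKit : SectionKit := by
  sorry

/-- **Stub S7 (XL, the lead's): the one-point budget from the engines.** See `OnePointBudget` and the PLAN
in the module docstring (uses also the landed `JacobianBudget.stub_eulerTransform`,
`JacobianBudget.stub_singleStepN1`). [folklore] -/
theorem stub_exceptionalBudget :
    TransformKit → PolarAdditivity → MixedNoether → GaussAvoidance → AutKit → SectionKit →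
      OnePointBudget := by
  sorry

/-! ## The composition (sorry-free): stubs ⇒ a step never raises `mu` ⇒ the crux BY NAME -/

/-- ONE STEP over a perfect field: extend scalars to the algebraic closure (`BaseChange`), get finiteness
of the exceptional critical scheme (`NoExcess`), apply the budget. [folklore] -/
theorem singleStep_of (hBC : BaseChange) (hNE : NoExcess) (hB : OnePointBudget) :
    ∀ p : ℕ, p.Prime → ∀ n : ℕ, 0 < n → ∀ (κ : Type) [Field κ] [CharP κ p] [PerfectField κ]
      (c : (Fin n → ℕ) → κ) (i : Fin n) (τ : Fin n → κ),
      Isol p n κ c → MultP p n κ c → Isol p n κ (step p n κ i τ c) → MultP p n κ (step p n κ i τ c) →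
        mu p n κ (step p n κ i τ c) ≤ mu p n κ c := by
  intro p hp n hn κ _ _ _ c i τ hI hM hI' hM'
  haveI : CharP (AlgebraicClosure κ) p :=
    charP_of_injective_algebraMap (algebraMap κ (AlgebraicClosure κ)).injective p
  obtain ⟨hIso, hMul, hmu, hstep⟩ := hBC p n κ (AlgebraicClosure κ) c i τ
  obtain ⟨hIso2, hMul2, hmu2, -⟩ := hBC p n κ (AlgebraicClosure κ) (step p n κ i τ c) i τ
  have hI1 := hIso.mp hI
  have hM1 := hMul.mp hM
  have hI2 := hIso2.mp hI'
  have hM2 := hMul2.mp hM'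
  rw [hstep] at hI2 hM2
  have hEF := hNE p hp n hn (AlgebraicClosure κ) _ i _ hI1 hM1 hI2 hM2
  have key := hB p hp n hn (AlgebraicClosure κ) _ i _ hI1 hM1 hEF hI2 hM2
  rw [hmu, hmu2, hstep]
  exact key

/-- **THE SKELETON THEOREM: `BoundedMilnor` from the seven stub statements — no `sorry` in its closure.**
The crux's thirteen `let`s are the `WildCones` calculus verbatim, so after `intro` the identification is
definitional; a step never raises `mu` (`singleStep_of`), so `β := mu (run 0)` bounds the chain. Every
stub is consumed. [folklore] -/
theorem BoundedMilnor_of :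
    Sig.stub_sharedKits → Sig.stub_mixedNoether → Sig.stub_transformKit → Sig.stub_autKit →
      Sig.stub_gaussAvoidance → Sig.stub_sectionKit → Sig.stub_exceptionalBudget →
        FrobeniusClosing.BoundedMilnor := by
  intro hK hMN hT hA hGA hS hEB
  intro p hp n hn κ _ _ _ c₀ i t
  intro clean' bl' ord' dv' tr' step' run' ser' pd' jac' Isol' MultP' mu' hchain
  have h1 := singleStep_of hK.1 hK.2.1 (hEB hT hK.2.2 hMN hGA hA hS) p hp n hn κ
  have hmono : ∀ m, mu p n κ (run p n κ c₀ i t (m + 1)) ≤ mu p n κ (run p n κ c₀ i t m) := fun m =>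
    h1 (run p n κ c₀ i t m) (i m) (t m) (hchain m).1 (hchain m).2 (hchain (m + 1)).1 (hchain (m + 1)).2
  refine ⟨mu p n κ (run p n κ c₀ i t 0), fun m => ?_⟩
  induction m with
  | zero => exact le_rfl
  | succ m ih => exact (hmono m).trans ih

/-- **The crux, assembled from the seven registered stubs** (the only `sorry`s in its closure are the
`stub_*`). -/
theorem BoundedMilnor_proof : FrobeniusClosing.BoundedMilnor :=
  BoundedMilnor_of stub_sharedKits stub_mixedNoether stub_transformKit stub_autKit stub_gaussAvoidance
    stub_sectionKit stub_exceptionalBudget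

end Summit.ResolutionOfSingularities.ResolutionOfSingularities.Theorems.BoundedMilnorBudget

end
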